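import Mathlib
import Literature.NumberTheory.DiophantineGeometry.GLHighestWeightIsomorphismProofs
import Literature.NumberTheory.DiophantineGeometry.GLPolynomialRepSemisimpleProofs
import Summits.MatrixMultiplication.MatrixMultiplication.Theorems.GLnSeparatingDesignsSeparationDegreeCostBlockArithmetic
import Summits.MatrixMultiplication.MatrixMultiplication.Theorems.GLnSeparatingDesignsSeparationDegreeCostStubMonomialCount

/-!
# The `U⁻`-translates of a column-homogeneous polynomial span few dimensions
# (`GLnSeparatingDesigns.SeparationDegreeCost`, BCGPU 2024 Lemma 2.7, counting form)

Crux `stmt-MatrixMultiplication-18361` (route `GLnSeparatingDesigns`), line `SketchIdeator1`, lead's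
stub `stub_finrank_irreducible_le`, file 2 of its chain (registered helper stub
`finrank_span_lowerTranslates_le`):

  if every monomial of `v ∈ ℂ[x_{ij}]` (`n × n` variables) has column sums `χ` with `Σ χ ≤ s`,
  `n ≥ 3`, `s ≥ 2`, then `dim span {R_{u(A)} v : A} ≤ s^{n(n-1)/2}`,

where `R_g` is right translation `(R_g p)(x) = p(x g)` (tree `matTransl`) and `u(A)` the lower
unitriangular matrix with strictly lower entries those of `A` (tree `lowerUnitriMatrix`). Proof:
the GENERIC lower-unitriangular translate `Ψ : x_{ab} ↦ x_{ab} + Σ_{l>b} y_{lb} x_{al}` is a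
`ℂ`-algebra map into the polynomials in the parameters `y_{lb}` with coefficients in `ℂ[x]`
(`aeval_lowerTranslate`: its specialisation `y := A` is `R_{u(A)}`), so every translate is a
combination of the finitely many coefficients `coeff_e (Ψ v)` (`matTransl_lowerUnitri_mem_span`); the
exponents `e` occurring are supported below the diagonal with column totals `Σ_l e(l,b) ≤ χ_b`
(`apply_mem_restrictSupport_box`, via Mathlib's `restrictSupport_add`), and there are at most
`∏_b C(χ_b + (n-1-b), n-1-b)` of those (`card_le_of_subset_box`, through the monomial count
`nat_card_setOf_sum_le_eq_choose` of the stub file `…StubMonomialCount`), which is `≤ s^{n(n-1)/2}`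
(`prod_choose_colDegree_le_pow`, file `…BlockArithmetic`). This is the column-refined degree count
of card `big-cell-block-bound` (Cruxes/SeparationDegreeCost/Ideas), replacing the Weyl dimension
formula in Blasiak–Cohn–Grochow–Pratt–Umans 2024 (arXiv:2410.14905), Lemma 2.7.
-/

-- `Summit.MatrixMultiplication.MatrixMultiplication.…` is the tree's mandated summit-side namespace
-- (single-conjunct summit: Sub = Summit), which the `dupNamespace` linter would flag on every decl.
set_option linter.dupNamespace false

noncomputable section

open scoped BigOperators Pointwise
open Literature.NumberTheory.DiophantineGeometry MvPolynomial

namespace Summit.MatrixMultiplication.MatrixMultiplication.Theorems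

variable {σ : Type*} [Fintype σ] [LinearOrder σ] {k : Type*} [Field k]

/-! Throughout, `Ψ` is "the" generic lower-unitriangular right translate
`x_{ab} ↦ x_{ab} + Σ_{l > b} y_{lb} x_{al}` — a `k`-algebra map into the polynomials in the
parameters `y_{lb}` (variables `X (l, b)` of the outer ring; only `b < l` occur) with coefficients
in `k[x_{ij}]`, characterised by its values `hΨ` on the variables (it is `MvPolynomial.aeval _`). -/

omit [Fintype σ] in
/-- Entries of `lowerUnitriMatrix` as the sum of its strictly lower and diagonal parts. -/
theorem lowerUnitriMatrix_apply_eq_add (a : LowIdx σ → k) (l b : σ) :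
    lowerUnitriMatrix a l b =
      (if h : b < l then a ⟨(l, b), h⟩ else 0) + (if l = b then 1 else 0) := by
  rcases lt_trichotomy b l with h | rfl | h
  · rw [lowerUnitriMatrix_apply_of_lt a h, dif_pos h, if_neg (ne_of_gt h), add_zero]
  · rw [lowerUnitriMatrix_apply_self, dif_neg (lt_irrefl b), if_pos rfl, zero_add]
  · rw [lowerUnitriMatrix_apply_of_gt a h, dif_neg (not_lt.2 h.le), if_neg (ne_of_lt h), add_zero]

/-- **Specialisation.** Substituting the strictly lower entries of a matrix `A` for the parameters
in the generic translate gives the right translation by the lower unitriangular matrix with those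
entries: `Ψ(w)|_{y := A} = R_{u(A)} w`. -/
theorem aeval_lowerTranslate
    (Ψ : MvPolynomial (σ × σ) k →ₐ[k] MvPolynomial (σ × σ) (MvPolynomial (σ × σ) k))
    (hΨ : ∀ ij : σ × σ, Ψ (X ij) = C (X ij) +
      ∑ l : σ, (if ij.2 < l then X (l, ij.2) * C (X (ij.1, l)) else 0))
    (A : Matrix σ σ k) (w : MvPolynomial (σ × σ) k) :
    MvPolynomial.aeval (fun q : σ × σ => (C (A q.1 q.2) : MvPolynomial (σ × σ) k)) (Ψ w) =
      matTransl σ k (lowerUnitriMatrix fun p : LowIdx σ => A p.1.1 p.1.2) w := by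
  -- both sides are `k`-algebra maps in `w`; compare them on the variables
  set F : MvPolynomial (σ × σ) k →ₐ[k] MvPolynomial (σ × σ) k :=
    ((MvPolynomial.aeval (fun q : σ × σ =>
      (C (A q.1 q.2) : MvPolynomial (σ × σ) k))).restrictScalars k).comp Ψ with hF
  have hFw : F w = MvPolynomial.aeval (fun q : σ × σ =>
      (C (A q.1 q.2) : MvPolynomial (σ × σ) k)) (Ψ w) := rfl
  rw [← hFw]
  congr 1
  refine MvPolynomial.algHom_ext fun ij => ?_
  obtain ⟨a, b⟩ := ij
  rw [hF, AlgHom.comp_apply, AlgHom.restrictScalars_apply, hΨ, map_add, map_sum, aeval_C,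
    matTransl_X]
  simp only [Algebra.algebraMap_self, RingHom.id_apply]
  -- right-hand side: split the entries of `u(A)`
  have hr : ∑ l, lowerUnitriMatrix (fun p : LowIdx σ => A p.1.1 p.1.2) l b • (X (a, l) :
      MvPolynomial (σ × σ) k) = X (a, b) + ∑ l, (if b < l then A l b • X (a, l) else 0) := by
    simp only [lowerUnitriMatrix_apply_eq_add, add_smul, Finset.sum_add_distrib, ite_smul,
      one_smul, zero_smul, Finset.sum_ite_eq', Finset.mem_univ, if_true]
    rw [add_comm]
    congr 1
    refine Finset.sum_congr rfl fun l _ => ?_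
    by_cases h : b < l <;> simp [h]
  rw [hr]
  congr 1
  refine Finset.sum_congr rfl fun l _ => ?_
  by_cases h : b < l
  · rw [if_pos h, if_pos h, map_mul, aeval_X, aeval_C, Algebra.algebraMap_self, RingHom.id_apply,
      smul_eq_C_mul]
  · rw [if_neg h, if_neg h, map_zero]

omit [LinearOrder σ] in
/-- **Expansion in the parameters.** Specialising the parameters of a polynomial `Q` over
`k[x_{ij}]` at the entries of `A` gives the combination `Σ_e A^e • coeff_e Q` of its coefficients. -/
theorem aeval_C_entries_eq_sum (A : Matrix σ σ k)
    (Q : MvPolynomial (σ × σ) (MvPolynomial (σ × σ) k)) :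
    MvPolynomial.aeval (fun q : σ × σ => (C (A q.1 q.2) : MvPolynomial (σ × σ) k)) Q =
      ∑ e ∈ Q.support, (∏ q, A q.1 q.2 ^ e q) • coeff e Q := by
  rw [MvPolynomial.aeval_eq_eval₂Hom, MvPolynomial.coe_eval₂Hom, MvPolynomial.eval₂_eq']
  refine Finset.sum_congr rfl fun e _ => ?_
  rw [Algebra.algebraMap_self, RingHom.id_apply, smul_eq_C_mul, mul_comm, map_prod]
  simp only [map_pow]

/-- Hence every lower-unitriangular right translate `R_{u(A)} w` lies in the span of the finitely
many coefficients of the generic translate `Ψ w`. -/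
theorem matTransl_lowerUnitri_mem_span
    (Ψ : MvPolynomial (σ × σ) k →ₐ[k] MvPolynomial (σ × σ) (MvPolynomial (σ × σ) k))
    (hΨ : ∀ ij : σ × σ, Ψ (X ij) = C (X ij) +
      ∑ l : σ, (if ij.2 < l then X (l, ij.2) * C (X (ij.1, l)) else 0))
    (A : Matrix σ σ k) (w : MvPolynomial (σ × σ) k) :
    matTransl σ k (lowerUnitriMatrix fun p : LowIdx σ => A p.1.1 p.1.2) w ∈
      Submodule.span k ((fun e => coeff e (Ψ w)) '' ((Ψ w).support : Set (σ × σ →₀ ℕ))) := by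
  rw [← aeval_lowerTranslate Ψ hΨ A w, aeval_C_entries_eq_sum]
  refine Submodule.sum_mem _ fun e he => Submodule.smul_mem _ _ (Submodule.subset_span ?_)
  exact ⟨e, Finset.mem_coe.2 he, rfl⟩

/-! ### Column-bounded exponents -/

-- `Box[w]`: the exponents `e` (in the parameters `y_{lb}`) supported on strictly lower positions
-- whose column totals are bounded by `w`: `Σ_l e(l,b) ≤ w b` (local notation only).
set_option quotPrecheck false in
local notation "Box[" w "]" =>
  {e : σ × σ →₀ ℕ | (∀ b, ∑ l, e (l, b) ≤ (w : σ → ℕ) b) ∧ ∀ q : σ × σ, ¬ q.2 < q.1 → e q = 0}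

omit [LinearOrder σ] in
/-- Column totals are additive, so boxes add. -/
theorem box_add_subset [LT σ] (w w' : σ → ℕ) : (Box[w] + Box[w'] : Set (σ × σ →₀ ℕ)) ⊆ Box[w + w'] := by
  rintro _ ⟨e, ⟨he1, he2⟩, e', ⟨he1', he2'⟩, rfl⟩
  refine ⟨fun b => ?_, fun q hq => ?_⟩
  · simp only [Finsupp.coe_add, Pi.add_apply, Finset.sum_add_distrib]
    exact add_le_add (he1 b) (he1' b)
  · simp [he2 q hq, he2' q hq]

omit [LinearOrder σ] in
/-- `0` lies in every box. -/
theorem zero_mem_box [LT σ] (w : σ → ℕ) : (0 : σ × σ →₀ ℕ) ∈ Box[w] := by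
  refine ⟨fun b => by simp, fun q _ => rfl⟩

omit [LinearOrder σ] in
/-- Boxes are monotone in the bound. -/
theorem box_mono [LT σ] {w w' : σ → ℕ} (h : w ≤ w') : (Box[w] : Set (σ × σ →₀ ℕ)) ⊆ Box[w'] :=
  fun _ ⟨he1, he2⟩ => ⟨fun b => (he1 b).trans (h b), he2⟩

variable {R : Type*} [CommRing R]

omit [LinearOrder σ] in
/-- Products of column-bounded polynomials are column-bounded by the sum of the bounds. -/
theorem mul_mem_restrictSupport_box [LT σ] {w w' : σ → ℕ} {x y : MvPolynomial (σ × σ) R}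
    (hx : x ∈ restrictSupport R (Box[w])) (hy : y ∈ restrictSupport R (Box[w'])) :
    x * y ∈ restrictSupport R (Box[w + w']) := by
  have h := Submodule.mul_mem_mul hx hy
  rw [← restrictSupport_add] at h
  exact restrictSupport_mono _ (box_add_subset w w') h

omit [LinearOrder σ] in
/-- Finite products of column-bounded polynomials. -/
theorem prod_mem_restrictSupport_box [LT σ] {ι : Type*} (s : Finset ι) (x : ι → MvPolynomial (σ × σ) R)
    (w : ι → σ → ℕ) (h : ∀ i ∈ s, x i ∈ restrictSupport R (Box[w i])) :
    ∏ i ∈ s, x i ∈ restrictSupport R (Box[∑ i ∈ s, w i]) := by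
  classical
  induction s using Finset.induction_on with
  | empty =>
    rw [Finset.prod_empty, Finset.sum_empty, show (1 : MvPolynomial (σ × σ) R) = monomial 0 1 from rfl,
      monomial_mem_restrictSupport]
    exact Or.inl (zero_mem_box 0)
  | insert i s hi ih =>
    rw [Finset.prod_insert hi, Finset.sum_insert hi]
    exact mul_mem_restrictSupport_box (h i (Finset.mem_insert_self i s))
      (ih fun j hj => h j (Finset.mem_insert_of_mem hj))

omit [LinearOrder σ] in
/-- Powers of column-bounded polynomials. -/
theorem pow_mem_restrictSupport_box [LT σ] {w : σ → ℕ} {x : MvPolynomial (σ × σ) R}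
    (hx : x ∈ restrictSupport R (Box[w])) (m : ℕ) : x ^ m ∈ restrictSupport R (Box[m • w]) := by
  have h := prod_mem_restrictSupport_box (Finset.range m) (fun _ => x) (fun _ => w) fun _ _ => hx
  rwa [Finset.prod_const, Finset.card_range, Finset.sum_const, Finset.card_range] at h

/-- The image `Ψ x_{ab} = x_{ab} + Σ_{l>b} y_{lb} x_{al}` of a variable is column-bounded by the
indicator of column `b`. -/
theorem apply_X_mem_restrictSupport_box
    (Ψ : MvPolynomial (σ × σ) k →ₐ[k] MvPolynomial (σ × σ) (MvPolynomial (σ × σ) k))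
    (hΨ : ∀ ij : σ × σ, Ψ (X ij) = C (X ij) +
      ∑ l : σ, (if ij.2 < l then X (l, ij.2) * C (X (ij.1, l)) else 0))
    (ab : σ × σ) :
    Ψ (X ab) ∈ restrictSupport (MvPolynomial (σ × σ) k) (Box[Pi.single ab.2 1]) := by
  classical
  rw [hΨ]
  refine Submodule.add_mem _ ?_ (Submodule.sum_mem _ fun l _ => ?_)
  · rw [show (C (X ab) : MvPolynomial (σ × σ) (MvPolynomial (σ × σ) k)) = monomial 0 (X ab) from rfl,
      monomial_mem_restrictSupport]
    exact Or.inl (zero_mem_box _)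
  · by_cases h : ab.2 < l
    · rw [if_pos h, mul_comm, C_mul_X_eq_monomial, monomial_mem_restrictSupport]
      refine Or.inl ⟨fun b => ?_, fun q hq => ?_⟩
      · by_cases hb : b = ab.2
        · subst hb
          rw [Pi.single_eq_same]
          refine le_of_eq ?_
          calc ∑ l', (Finsupp.single (l, ab.2) 1 : σ × σ →₀ ℕ) (l', ab.2)
              = ∑ l', (if l' = l then 1 else 0) := Finset.sum_congr rfl fun l' _ => by
                  rw [Finsupp.single_apply]; simp [Prod.ext_iff, eq_comm]
            _ = 1 := by simp
        · rw [Pi.single_eq_of_ne hb]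
          refine (Finset.sum_eq_zero fun l' _ => ?_).le
          rw [Finsupp.single_apply, if_neg]
          exact fun h' => hb (congrArg Prod.snd h').symm
      · rw [Finsupp.single_apply, if_neg]
        rintro rfl
        exact hq h
    · rw [if_neg h]
      exact Submodule.zero_mem _

/-- The generic translate of a monomial `x^m` is column-bounded by the column sums of `m`. -/
theorem apply_monomial_mem_restrictSupport_box
    (Ψ : MvPolynomial (σ × σ) k →ₐ[k] MvPolynomial (σ × σ) (MvPolynomial (σ × σ) k))
    (hΨ : ∀ ij : σ × σ, Ψ (X ij) = C (X ij) +
      ∑ l : σ, (if ij.2 < l then X (l, ij.2) * C (X (ij.1, l)) else 0))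
    (m : σ × σ →₀ ℕ) (a : k) :
    Ψ (monomial m a) ∈ restrictSupport (MvPolynomial (σ × σ) k) (Box[fun b => ∑ a', m (a', b)]) := by
  classical
  rw [monomial_eq, map_mul, MvPolynomial.algHom_C, Algebra.algebraMap_eq_smul_one, smul_mul_assoc,
    one_mul]
  refine Submodule.smul_of_tower_mem _ a ?_
  rw [Finsupp.prod, map_prod]
  simp only [map_pow]
  -- `Σ_{ij ∈ supp m} m ij • δ_{ij.2} = (b ↦ Σ_{a'} m (a', b))`
  have heq : (∑ ij ∈ m.support, m ij • (Pi.single ij.2 (1 : ℕ) : σ → ℕ)) = fun b => ∑ a', m (a', b) := by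
    funext b
    rw [Finset.sum_apply]
    simp only [Pi.smul_apply, smul_eq_mul]
    rw [Finset.sum_subset (Finset.subset_univ m.support) (fun ij _ hij => by
        rw [Finsupp.notMem_support_iff.1 hij, zero_mul]),
      Fintype.sum_prod_type]
    refine Finset.sum_congr rfl fun a' _ => ?_
    rw [Finset.sum_eq_single b (fun b' _ hb' => by
        rw [show (a', b').2 = b' from rfl, Pi.single_eq_of_ne' hb', mul_zero])
      (fun hb => absurd (Finset.mem_univ b) hb), show (a', b).2 = b from rfl, Pi.single_eq_same,
      mul_one]
  have h := prod_mem_restrictSupport_box (R := MvPolynomial (σ × σ) k) m.support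
    (fun ij => Ψ (X ij) ^ m ij) (fun ij => m ij • (Pi.single ij.2 (1 : ℕ) : σ → ℕ))
    fun ij _ => pow_mem_restrictSupport_box (apply_X_mem_restrictSupport_box Ψ hΨ ij) (m ij)
  rw [heq] at h
  exact h

/-- **Support bound.** If every monomial of `v` has column sums `χ`, then the generic
lower-unitriangular translate `Ψ v` involves only parameter monomials `y^e` supported below the
diagonal with column totals `Σ_l e(l,b) ≤ χ b`. -/
theorem apply_mem_restrictSupport_box
    (Ψ : MvPolynomial (σ × σ) k →ₐ[k] MvPolynomial (σ × σ) (MvPolynomial (σ × σ) k))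
    (hΨ : ∀ ij : σ × σ, Ψ (X ij) = C (X ij) +
      ∑ l : σ, (if ij.2 < l then X (l, ij.2) * C (X (ij.1, l)) else 0))
    (χ : σ → ℕ) (v : MvPolynomial (σ × σ) k) (hv : ∀ m ∈ v.support, ∀ b, ∑ a, m (a, b) = χ b) :
    Ψ v ∈ restrictSupport (MvPolynomial (σ × σ) k) (Box[χ]) := by
  rw [v.as_sum, map_sum]
  refine Submodule.sum_mem _ fun m hm => ?_
  have h := apply_monomial_mem_restrictSupport_box Ψ hΨ m (coeff m v)
  have e : (fun b => ∑ a', m (a', b)) = χ := funext (hv m hm)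
  rwa [e] at h

/-! ### Counting column-bounded exponents -/

/-- **Count.** A finite set of exponents supported below the diagonal with column totals `≤ χ`
has at most `∏_b C(χ b + k_b, k_b)` elements, `k_b = #{l | b < l}`: column by column it is a tuple
of exponent vectors on `{l | b < l}` of total `≤ χ b`. -/
theorem card_le_of_subset_box (χ : σ → ℕ) (t : Finset (σ × σ →₀ ℕ))
    (ht : (t : Set (σ × σ →₀ ℕ)) ⊆ Box[χ]) :
    t.card ≤ ∏ b, (χ b + Fintype.card {l : σ // b < l}).choose (Fintype.card {l : σ // b < l}) := by
  classical
  -- column data: exponent vectors on `{l | b < l}` of total `≤ χ b`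
  let S : ∀ b : σ, Set ({l : σ // b < l} →₀ ℕ) := fun b => {f | (f.sum fun _ e => e) ≤ χ b}
  haveI hfin : ∀ b, Finite (S b) := fun b =>
    haveI : Module.Finite ℂ (restrictSupport ℂ (S b)) :=
      show Module.Finite ℂ (restrictTotalDegree {l : σ // b < l} ℂ (χ b)) from inferInstance
    Module.Finite.finite_basis (basisRestrictSupport ℂ (S b))
  let Θ : (∀ b, S b) → (σ × σ →₀ ℕ) := fun f =>
    Finsupp.equivFunOnFinite.symm fun q => if h : q.2 < q.1 then (f q.2).1 ⟨q.1, h⟩ else 0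
  -- every boxed exponent is a `Θ f`
  have hsurj : (Box[χ] : Set (σ × σ →₀ ℕ)) ⊆ Set.range Θ := by
    rintro e ⟨he1, he2⟩
    refine ⟨fun b => ⟨Finsupp.equivFunOnFinite.symm fun l => e (l.1, b), ?_⟩, ?_⟩
    · change ((Finsupp.equivFunOnFinite.symm fun l : {l : σ // b < l} => e (l.1, b)).sum
        fun _ e => e) ≤ χ b
      rw [Finsupp.sum_fintype _ _ (fun _ => rfl)]
      simp only [Finsupp.coe_equivFunOnFinite_symm]
      refine le_trans ?_ (he1 b)
      rw [← Finset.sum_subtype (p := fun l : σ => b < l) (Finset.univ.filter fun l => b < l)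
        (fun l => by simp) (fun l => e (l, b))]
      exact Finset.sum_le_univ_sum_of_nonneg fun _ => Nat.zero_le _
    · ext q
      simp only [Θ, Finsupp.coe_equivFunOnFinite_symm]
      by_cases h : q.2 < q.1
      · rw [dif_pos h]
      · rw [dif_neg h, he2 q h]
  calc t.card = (t : Set (σ × σ →₀ ℕ)).ncard := (Set.ncard_coe_finset t).symm
    _ ≤ (Set.range Θ).ncard := Set.ncard_le_ncard (ht.trans hsurj) (Set.finite_range Θ)
    _ ≤ Nat.card (∀ b, S b) := by
        rw [← Set.image_univ, ← Set.ncard_univ]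
        exact Set.ncard_image_le Set.finite_univ
    _ = ∏ b, Nat.card (S b) := Nat.card_pi
    _ = ∏ b, (χ b + Fintype.card {l : σ // b < l}).choose (Fintype.card {l : σ // b < l}) :=
        Finset.prod_congr rfl fun b _ => nat_card_setOf_sum_le_eq_choose _ _

/-- `#{l : Fin n | b < l} = n - 1 - b`. -/
theorem card_subtype_fin_gt {n : ℕ} (b : Fin n) : Fintype.card {l : Fin n // b < l} = n - 1 - (b : ℕ) := by
  rw [Fintype.card_congr (Equiv.subtypeEquivRight (fun l => (Finset.mem_Ioi (a := b) (x := l)).symm)),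
    Fintype.card_coe, Fin.card_Ioi]

/-- **Dimension bound for the `U⁻`-translates of a column-homogeneous polynomial.** If every
monomial of `v ∈ ℂ[x_{ij}]` (`n × n` variables) has column sums `χ` with `Σ χ ≤ s`, `n ≥ 3`,
`s ≥ 2`, then the span of the right translates `R_{u(A)} v` by all lower unitriangular matrices has
dimension `≤ s^{n(n-1)/2}` (BCGPU 2024 Lemma 2.7, counting form): each translate is a combination of
the coefficients of the generic translate, which are indexed by column-bounded exponents. -/
theorem finrank_span_lowerTranslates_le {n s : ℕ} (hn : 3 ≤ n) (hs : 2 ≤ s) (χ : Fin n → ℕ)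
    (hχ : ∑ j, χ j ≤ s) (v : MvPolynomial (Fin n × Fin n) ℂ)
    (hv : ∀ m ∈ v.support, ∀ b, ∑ a, m (a, b) = χ b) :
    Module.finrank ℂ (Submodule.span ℂ (Set.range fun A : Matrix (Fin n) (Fin n) ℂ =>
      matTransl (Fin n) ℂ (lowerUnitriMatrix fun p : LowIdx (Fin n) => A p.1.1 p.1.2) v)) ≤
      s ^ (n * (n - 1) / 2) := by
  classical
  -- the generic translate
  let Ψ : MvPolynomial (Fin n × Fin n) ℂ →ₐ[ℂ]
      MvPolynomial (Fin n × Fin n) (MvPolynomial (Fin n × Fin n) ℂ) :=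
    MvPolynomial.aeval fun ij : Fin n × Fin n => C (X ij) +
      ∑ l : Fin n, (if ij.2 < l then X (l, ij.2) * C (X (ij.1, l)) else 0)
  have hΨ : ∀ ij : Fin n × Fin n, Ψ (X ij) = C (X ij) +
      ∑ l : Fin n, (if ij.2 < l then X (l, ij.2) * C (X (ij.1, l)) else 0) := fun ij =>
    MvPolynomial.aeval_X _ ij
  set T : Finset (MvPolynomial (Fin n × Fin n) ℂ) := (Ψ v).support.image fun e => coeff e (Ψ v)
    with hT
  have h1 : Submodule.span ℂ (Set.range fun A : Matrix (Fin n) (Fin n) ℂ =>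
      matTransl (Fin n) ℂ (lowerUnitriMatrix fun p : LowIdx (Fin n) => A p.1.1 p.1.2) v) ≤
      Submodule.span ℂ (T : Set (MvPolynomial (Fin n × Fin n) ℂ)) := by
    refine Submodule.span_le.2 ?_
    rintro _ ⟨A, rfl⟩
    have h := matTransl_lowerUnitri_mem_span Ψ hΨ A v
    rwa [hT, Finset.coe_image]
  have h5 : (Ψ v).support.card ≤ ∏ b : Fin n, (χ b + (n - 1 - (b : ℕ))).choose (n - 1 - (b : ℕ)) := by
    have h := card_le_of_subset_box χ (Ψ v).support
      ((mem_restrictSupport_iff _).1 (apply_mem_restrictSupport_box Ψ hΨ χ v hv))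
    simpa only [card_subtype_fin_gt] using h
  calc Module.finrank ℂ _ ≤ Module.finrank ℂ (Submodule.span ℂ (T : Set (MvPolynomial (Fin n × Fin n) ℂ))) :=
        Submodule.finrank_mono h1
    _ ≤ T.card := finrank_span_finset_le_card T
    _ ≤ (Ψ v).support.card := Finset.card_image_le
    _ ≤ ∏ b : Fin n, (χ b + (n - 1 - (b : ℕ))).choose (n - 1 - (b : ℕ)) := h5
    _ ≤ s ^ (n * (n - 1) / 2) := prod_choose_colDegree_le_pow hn hs χ hχ

end Summit.MatrixMultiplication.MatrixMultiplication.Theorems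

end
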